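import Mathlib
import Summits.CriticalPhenomena.PercolationContinuityZ3.Theses.PercAnnulusCrossing
import Literature.Probability.Percolation.BlockResampling
import Literature.Probability.Percolation.InfiniteClusterDensity
import HarnessLib

/-!
# Crux `PercTreeValue.TetrahedronHarrisGap` (stmt-CriticalPhenomena-7799), line `SketchIdeator1` — stub `stub_block`

Helper file for the lead's skeleton of line `SketchIdeator1` (corner-ball total covariance,
`Cruxes/TetrahedronHarrisGap/Lines/SketchIdeator1.lean`, prover-line-stmt-CriticalPhenomena-7799-0).
The registered stub `stub_block` (blocking: with probability `≥ c_B` the bulk admits no hook at all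
between two corners of the tetrahedron `T_r`) is an RSW-type statement, open as stated; this file
proves its CONDITIONAL form `stub_block_of_critAnnulusNonCrossing`: the stub follows from the route
decl `PercAnnulusCrossing.CritAnnulusNonCrossing` (item stmt-CriticalPhenomena-0846, taken as the
antecedent of the implication, never as a free-standing hypothesis). Lands with
`--supports stmt-CriticalPhenomena-7799`.

Write `K = K_r` for the lattice edges touching one of the four corner boxes of sup-radius `m = r/8`
around `0, a = (r,r,0), b = (r,0,r), c = (0,r,r)`, and `f(ω) = blockCondProb K {z ↔ t} ω`
(`= Σ_{ξ ⊆ K} P(obs K = ξ) 𝟙{ω ∖ K ∪ ξ ∈ {z ↔ t}}`) for an edge `{z, t}` of `T_r`.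

* `StubBlock.exists_crossing_of_reachable` (deterministic core, any dimension): if a lattice
  configuration `ω'` joins `0` to a point `t ∉ B(2(m+1))`, and every edge of `ω'` inside
  `B(2(m+1))` with both endpoints off `B(m)` is an edge of `ω`, then `ω` contains an open path of
  `B(2(m+1))` from `B(m+1)` to `∂ⁱⁿB(2(m+1))` — the segment of the path between its last visit to
  `B(m+1)` before the first exit from `B(2(m+1))` and that exit (two applications of the first-exit
  lemma `exists_prefix_within_edges`; neighbours differ by at most one per coordinate,
  `zdGraph_adj_apply_le`).
* `StubBlock.blockCondProb_openConn_eq_zero`: hence, after translating the corner `z` to the origin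
  (`BondConfig.relabel (sym2Equiv (Site.shift (-z)))`, `openGraph_relabel_adj_iff`), every glued
  configuration `ω ∖ K ∪ ξ` misses `{z ↔ t}` as soon as the translate of `ω` misses the annulus
  crossing event of `CritAnnulusNonCrossing` at `n = m + 1`, provided `K` has no edge in the annulus
  `B(z, 2(m+1)) ∖ B(z, m)`; so `f(ω) = 0` there.
* `StubBlock.le_measureReal_blockCondProb_eq_zero`: `P(f = 0) ≥ 1 - P(crossing) ≥ c` (lattice
  configurations are almost sure, `DCT16.real_mono_of_forall_subset_edgeSet`; translation
  invariance `bondPercolation_real_preimage_shift`; subadditivity).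
* The corner boxes of the three other corners are at sup-distance `r - m > 2(m+1)` from the centre,
  so `K_r` has no edge in the annulus (`StubBlock.not_mem_cornerEdges_zero/_b`), for every `r ≥ 3`.
-/

noncomputable section

namespace Summit.CriticalPhenomena.PercolationContinuityZ3.Theorems.TetrahedronHarrisGap

open MeasureTheory Literature.Probability.Percolation Literature.Probability.LatticeModels

namespace StubBlock

/-- **Deterministic core.** Let `ω'` be a lattice configuration of `ℤ^d` joining `0` to a point
`t ∉ B(2(m+1))`, and suppose every `ω'`-open lattice edge with both endpoints in `B(2(m+1)) ∖ B(m)`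
is `ω`-open. Then `ω` has an open path inside `B(2(m+1))` from a point of `B(m+1)` to a point of
the inner vertex boundary `∂ⁱⁿB(2(m+1))`. -/
theorem exists_crossing_of_reachable {d : ℕ} {ω ω' : BondConfig (Site d)}
    (hω' : ω' ⊆ (zdGraph d).edgeSet) {m : ℕ} {t : Site d} (ht : t ∉ box d (2 * (m + 1)))
    (hK : ∀ u v : Site d, (zdGraph d).Adj u v → u ∈ box d (2 * (m + 1)) →
      v ∈ box d (2 * (m + 1)) → u ∉ box d m → v ∉ box d m → s(u, v) ∈ ω' → s(u, v) ∈ ω)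
    (h : (openGraph ω').Reachable 0 t) :
    ∃ x ∈ box d (m + 1), ∃ y ∈ innerBoundary (zdGraph d) (box d (2 * (m + 1))),
      ω ∈ openConnIn ↑(box d (2 * (m + 1))) x y := by
  classical
  obtain ⟨W⟩ := h
  have h0S : (0 : Site d) ∈ (↑(box d (2 * (m + 1))) : Set (Site d)) := by
    rw [Finset.mem_coe, mem_box]; intro i; simp only [Pi.zero_apply]; omega
  have htS : t ∉ (↑(box d (2 * (m + 1))) : Set (Site d)) := fun h' => ht (Finset.mem_coe.1 h')
  -- first exit of the path from the big box
  obtain ⟨f, g, hf, hg, hfg, W₁, -, -, hW₁⟩ := exists_prefix_within_edges _ W h0S htS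
  rw [Finset.mem_coe] at hf hg
  have hfgL : (zdGraph d).Adj f g := DCT16.adj_of_openGraph_adj hω' hfg
  have hfI : f ∈ innerBoundary (zdGraph d) (box d (2 * (m + 1))) :=
    mem_innerBoundary_iff.2 ⟨hf, g, hg, hfgL⟩
  -- `f ∉ B(m+1)`: otherwise its neighbour `g` would lie in `B(2(m+1))`
  have hfT : f ∈ ((↑(box d (m + 1)))ᶜ : Set (Site d)) := by
    rw [Set.mem_compl_iff, Finset.mem_coe]
    intro hfn
    apply hg
    rw [mem_box] at hfn ⊢
    intro i
    have h1 := zdGraph_adj_apply_le hfgL i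
    have h2 := hfn i
    push_cast at h2 ⊢
    constructor <;> omega
  have h0T : (0 : Site d) ∉ ((↑(box d (m + 1)))ᶜ : Set (Site d)) := by
    rw [Set.mem_compl_iff, not_not, Finset.mem_coe, mem_box]
    intro i; simp only [Pi.zero_apply]; omega
  -- last visit to the small box, seen backwards from `f`
  obtain ⟨f', g', hf', hg', hfg', W₂, hW₂supp, -, hW₂⟩ :=
    exists_prefix_within_edges _ W₁.reverse hfT h0T
  rw [Set.mem_compl_iff, Finset.mem_coe] at hf'
  rw [Set.mem_compl_iff, not_not, Finset.mem_coe] at hg'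
  have hfg'L : (zdGraph d).Adj f' g' := DCT16.adj_of_openGraph_adj hω' hfg'
  -- `g' ∉ B(m)`: otherwise its neighbour `f'` would lie in `B(m+1)`
  have hg'm : g' ∉ box d m := by
    intro hgm
    apply hf'
    rw [mem_box] at hgm ⊢
    intro i
    have h1 := zdGraph_adj_apply_le hfg'L i
    have h2 := hgm i
    push_cast at h2 ⊢
    constructor <;> omega
  have hg'S : g' ∈ box d (2 * (m + 1)) := box_mono d (by omega) hg'
  -- the open walk `g' → f' ⇝ f` (the segment of `W₂` reversed)
  let W₃ : (openGraph ω').Walk g' f := SimpleGraph.Walk.cons hfg'.symm W₂.reverse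
  have hW₃ : ∀ x ∈ W₃.support, x ∈ box d (2 * (m + 1)) ∧ x ∉ box d m := by
    intro x hx
    rw [SimpleGraph.Walk.support_cons, List.mem_cons, SimpleGraph.Walk.support_reverse,
      List.mem_reverse] at hx
    rcases hx with rfl | hx
    · exact ⟨hg'S, hg'm⟩
    · have h1 := hW₂supp x hx
      rw [SimpleGraph.Walk.support_reverse, List.mem_reverse] at h1
      have h2 : x ∉ (↑(box d (m + 1)) : Set (Site d)) := hW₂ x hx
      rw [Finset.mem_coe] at h2
      exact ⟨Finset.mem_coe.1 (hW₁ x h1), fun hxm => h2 (box_mono d (Nat.le_succ m) hxm)⟩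
  have hW₃ω : ∀ e ∈ W₃.edges, e ∈ ω := by
    intro e he
    induction e using Sym2.ind with
    | h u v =>
      have hadj : (openGraph ω').Adj u v := W₃.adj_of_mem_edges he
      have hu := hW₃ u (W₃.fst_mem_support_of_mem_edges he)
      have hv := hW₃ v (W₃.snd_mem_support_of_mem_edges he)
      exact hK u v (DCT16.adj_of_openGraph_adj hω' hadj) hu.1 hv.1 hu.2 hv.2
        ((openGraph_adj ω' u v).1 hadj).1
  exact ⟨g', hg', f, hfI,
    mem_openConnIn_of_walk W₃ (fun x hx => Finset.mem_coe.2 (hW₃ x hx).1) hW₃ω⟩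

/-- **Blocking from a non-crossing annulus (deterministic).** Let `K` be a finite set of lattice
edges none of which joins two points of the annulus `B(z, 2(m+1)) ∖ B(z, m)` around the corner
`z`, let `t ∉ B(z, 2(m+1))`, and let `ω` be a lattice configuration whose translate by `-z` has no
open path inside `B(2(m+1))` from `B(m+1)` to `∂ⁱⁿB(2(m+1))`. Then no glued configuration
`ω ∖ K ∪ ξ`, `ξ ⊆ K`, joins `z` to `t`, i.e. `P_p({z ↔ t} | ω off K) = 0`. -/
theorem blockCondProb_openConn_eq_zero {d : ℕ} (p : unitInterval) {K : Finset (Sym2 (Site d))}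
    (hKE : (↑K : Set (Sym2 (Site d))) ⊆ (zdGraph d).edgeSet) {z t : Site d} {m : ℕ}
    (ht : t + -z ∉ box d (2 * (m + 1)))
    (hK : ∀ u v : Site d, (zdGraph d).Adj u v → u ∈ box d (2 * (m + 1)) →
      v ∈ box d (2 * (m + 1)) → u ∉ box d m → v ∉ box d m → s(u + z, v + z) ∉ K)
    {ω : BondConfig (Site d)} (hω : ω ⊆ (zdGraph d).edgeSet)
    (hN : BondConfig.relabel (sym2Equiv (Site.shift (-z))) ω ∉
      {ω : BondConfig (Site d) | ∃ x ∈ box d (m + 1),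
        ∃ y ∈ innerBoundary (zdGraph d) (box d (2 * (m + 1))),
          ω ∈ openConnIn ↑(box d (2 * (m + 1))) x y}) :
    blockCondProb (zdGraph d) p K (openConn z t) ω = 0 := by
  classical
  unfold blockCondProb
  refine Finset.sum_eq_zero fun ξ hξ => ?_
  rw [Finset.mem_powerset] at hξ
  rw [Set.indicator_of_notMem, mul_zero]
  intro hconn
  apply hN
  have hω₁ : ω \ ↑K ∪ ↑ξ ⊆ (zdGraph d).edgeSet :=
    Set.union_subset (Set.sdiff_subset.trans hω) ((Finset.coe_subset.2 hξ).trans hKE)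
  have hshift : ∀ a b : Site d, (zdGraph d).Adj (a + z) (b + z) ↔ (zdGraph d).Adj a b :=
    fun a b => by
      have h := zdGraph_adj_shift_iff z a b
      rwa [Site.shift_apply, Site.shift_apply] at h
  -- the translated glued configuration is a lattice configuration …
  have hω₁' : BondConfig.relabel (sym2Equiv (Site.shift (-z))) (ω \ ↑K ∪ ↑ξ) ⊆
      (zdGraph d).edgeSet := by
    intro e
    induction e using Sym2.ind with
    | h a b =>
      intro he
      rw [BondConfig.mem_relabel_iff, sym2Equiv_symm, sym2Equiv_mk, Site.shift_symm_apply,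
        Site.shift_symm_apply, sub_neg_eq_add, sub_neg_eq_add] at he
      exact (hshift a b).1 (hω₁ he)
  -- … joining `0` to `t - z`
  have hreach : (openGraph (BondConfig.relabel (sym2Equiv (Site.shift (-z))) (ω \ ↑K ∪ ↑ξ))).Reachable
      0 (t + -z) := by
    let ψ : openGraph (ω \ ↑K ∪ ↑ξ) ≃g
        openGraph (BondConfig.relabel (sym2Equiv (Site.shift (-z))) (ω \ ↑K ∪ ↑ξ)) :=
      { toEquiv := Site.shift (-z)
        map_rel_iff' := fun {a b} => openGraph_relabel_adj_iff (Site.shift (-z)) _ a b }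
    have h2 : (openGraph _).Reachable (ψ z) (ψ t) := ψ.reachable_iff.2 hconn
    have hz : ψ z = 0 := add_neg_cancel z
    have ht' : ψ t = t + -z := rfl
    rwa [hz, ht'] at h2
  refine exists_crossing_of_reachable hω₁' ht ?_ hreach
  intro u v hadj hu hv hum hvm he
  rw [BondConfig.mem_relabel_iff] at he ⊢
  rcases he with he | he
  · exact he.1
  · exfalso
    rw [sym2Equiv_symm, sym2Equiv_mk, Site.shift_symm_apply, Site.shift_symm_apply, sub_neg_eq_add,
      sub_neg_eq_add] at he
    exact hK u v hadj hu hv hum hvm (hξ (Finset.mem_coe.1 he))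

/-- **Blocking from a non-crossing annulus (probability).** Under the hypotheses of
`blockCondProb_openConn_eq_zero` on `K`, `z`, `t`, if the annulus crossing event at `n = m + 1` has
probability `≤ 1 - c`, then `P_p(P_p({z ↔ t} | ω off K) = 0) ≥ c` (translation invariance and
`P(Aᶜ) ≥ 1 - P(A)`). -/
theorem le_measureReal_blockCondProb_eq_zero {d : ℕ} (p : unitInterval) {K : Finset (Sym2 (Site d))}
    (hKE : (↑K : Set (Sym2 (Site d))) ⊆ (zdGraph d).edgeSet) {z t : Site d} {m : ℕ}
    (ht : t + -z ∉ box d (2 * (m + 1)))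
    (hK : ∀ u v : Site d, (zdGraph d).Adj u v → u ∈ box d (2 * (m + 1)) →
      v ∈ box d (2 * (m + 1)) → u ∉ box d m → v ∉ box d m → s(u + z, v + z) ∉ K)
    {c : ℝ}
    (hc : (bondPercolation (zdGraph d) p).real {ω : BondConfig (Site d) | ∃ x ∈ box d (m + 1),
        ∃ y ∈ innerBoundary (zdGraph d) (box d (2 * (m + 1))),
          ω ∈ openConnIn ↑(box d (2 * (m + 1))) x y} ≤ 1 - c) :
    c ≤ (bondPercolation (zdGraph d) p).real
      {ω | blockCondProb (zdGraph d) p K (openConn z t) ω = 0} := by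
  set C : Set (BondConfig (Site d)) := {ω : BondConfig (Site d) | ∃ x ∈ box d (m + 1),
    ∃ y ∈ innerBoundary (zdGraph d) (box d (2 * (m + 1))),
      ω ∈ openConnIn ↑(box d (2 * (m + 1))) x y} with hC
  have h1 : (bondPercolation (zdGraph d) p).real
      (BondConfig.relabel (sym2Equiv (Site.shift (-z))) ⁻¹' C) =
        (bondPercolation (zdGraph d) p).real C :=
    bondPercolation_real_preimage_shift (-z) p C
  have h2 : (bondPercolation (zdGraph d) p).real
      (BondConfig.relabel (sym2Equiv (Site.shift (-z))) ⁻¹' C)ᶜ ≤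
        (bondPercolation (zdGraph d) p).real
          {ω | blockCondProb (zdGraph d) p K (openConn z t) ω = 0} :=
    DCT16.real_mono_of_forall_subset_edgeSet (zdGraph d) p fun ω hω hωC =>
      blockCondProb_openConn_eq_zero p hKE ht hK hω hωC
  have h3 : (1 : ℝ) ≤ (bondPercolation (zdGraph d) p).real
      (BondConfig.relabel (sym2Equiv (Site.shift (-z))) ⁻¹' C) +
        (bondPercolation (zdGraph d) p).real
          (BondConfig.relabel (sym2Equiv (Site.shift (-z))) ⁻¹' C)ᶜ := by
    rw [← probReal_univ (μ := bondPercolation (zdGraph d) p),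
      ← Set.union_compl_self (BondConfig.relabel (sym2Equiv (Site.shift (-z))) ⁻¹' C)]
    exact measureReal_union_le _ _
  linarith

/-- Unpacking membership in `armEdges`: if the edge `{u + z, v + z}` touches the corner box
`B(x, m)` then `u + z - x` or `v + z - x` lies in `B(m)`. -/
theorem mem_box_or_of_mem_armEdges {d m : ℕ} {x z u v : Site d}
    (h : s(u + z, v + z) ∈ armEdges m x) : u + z + -x ∈ box d m ∨ v + z + -x ∈ box d m := by
  rw [mem_armEdges_iff, sym2Equiv_mk, Site.shift_apply, Site.shift_apply, mem_edgesTouching_iff] at h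
  obtain ⟨-, w, hw, hw'⟩ := h
  rcases Sym2.mem_iff.1 hw' with rfl | rfl
  · exact Or.inl hw
  · exact Or.inr hw

/-- A point of `B(2(m+1))` (relative to the centre `z`) is not within sup-distance `m` of a corner
`x` one of whose coordinates differs from that of `z` by more than `3m + 2`. -/
theorem add_neg_notMem_box_of_far {m : ℕ} {x z w : Site 3} {i : Fin 3}
    (hfar : (3 * m + 2 : ℤ) < x i - z i ∨ (3 * m + 2 : ℤ) < z i - x i)
    (hw : w ∈ box 3 (2 * (m + 1))) : w + z + -x ∉ box 3 m := by
  intro h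
  have h1 := (mem_box.1 hw) i
  have h2 := (mem_box.1 h) i
  simp only [Pi.add_apply, Pi.neg_apply] at h2
  push_cast at h1 h2
  omega

/-- A point off `B(m)` (relative to the centre `z`) is not within sup-distance `m` of `z`. -/
theorem add_neg_notMem_box_self {m : ℕ} {z w : Site 3} (hw : w ∉ box 3 m) :
    w + z + -z ∉ box 3 m := by
  rwa [add_neg_cancel_right]

/-- The corner edge set `K_r` (edges touching a corner box of radius `m = r/8`) has no edge joining
two points of the annulus `B(2(m+1)) ∖ B(m)` around the corner `0`, for `r ≥ 3`. -/
theorem not_mem_cornerEdges_zero (r : ℕ) (hr : 3 ≤ r) :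
    ∀ u v : Site 3, (zdGraph 3).Adj u v → u ∈ box 3 (2 * (r / 8 + 1)) → v ∈ box 3 (2 * (r / 8 + 1)) →
      u ∉ box 3 (r / 8) → v ∉ box 3 (r / 8) →
      s(u + 0, v + 0) ∉ (armEdges (r / 8) (0 : Site 3) ∪ armEdges (r / 8) ![(r : ℤ), (r : ℤ), 0] ∪
        armEdges (r / 8) ![(r : ℤ), 0, (r : ℤ)] ∪ armEdges (r / 8) ![0, (r : ℤ), (r : ℤ)]) := by
  intro u v _ hu hv hum hvm
  have hm : (3 * (r / 8 : ℕ) + 2 : ℤ) < r := by push_cast; omega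
  simp only [Finset.mem_union, not_or]
  refine ⟨⟨⟨fun h => ?_, fun h => ?_⟩, fun h => ?_⟩, fun h => ?_⟩
  · exact (mem_box_or_of_mem_armEdges h).elim (add_neg_notMem_box_self hum)
      (add_neg_notMem_box_self hvm)
  · have hfar : (3 * (r / 8 : ℕ) + 2 : ℤ) < (![(r : ℤ), (r : ℤ), 0] : Site 3) 0 - (0 : Site 3) 0 ∨
        (3 * (r / 8 : ℕ) + 2 : ℤ) < (0 : Site 3) 0 - (![(r : ℤ), (r : ℤ), 0] : Site 3) 0 := by
      left; simpa using hm
    exact (mem_box_or_of_mem_armEdges h).elim (add_neg_notMem_box_of_far hfar hu)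
      (add_neg_notMem_box_of_far hfar hv)
  · have hfar : (3 * (r / 8 : ℕ) + 2 : ℤ) < (![(r : ℤ), 0, (r : ℤ)] : Site 3) 0 - (0 : Site 3) 0 ∨
        (3 * (r / 8 : ℕ) + 2 : ℤ) < (0 : Site 3) 0 - (![(r : ℤ), 0, (r : ℤ)] : Site 3) 0 := by
      left; simpa using hm
    exact (mem_box_or_of_mem_armEdges h).elim (add_neg_notMem_box_of_far hfar hu)
      (add_neg_notMem_box_of_far hfar hv)
  · have hfar : (3 * (r / 8 : ℕ) + 2 : ℤ) < (![0, (r : ℤ), (r : ℤ)] : Site 3) 1 - (0 : Site 3) 1 ∨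
        (3 * (r / 8 : ℕ) + 2 : ℤ) < (0 : Site 3) 1 - (![0, (r : ℤ), (r : ℤ)] : Site 3) 1 := by
      left; simpa using hm
    exact (mem_box_or_of_mem_armEdges h).elim (add_neg_notMem_box_of_far hfar hu)
      (add_neg_notMem_box_of_far hfar hv)

/-- The corner edge set `K_r` has no edge joining two points of the annulus
`B(b, 2(m+1)) ∖ B(b, m)` around the corner `b = (r,0,r)`, for `r ≥ 3`. -/
theorem not_mem_cornerEdges_b (r : ℕ) (hr : 3 ≤ r) :
    ∀ u v : Site 3, (zdGraph 3).Adj u v → u ∈ box 3 (2 * (r / 8 + 1)) → v ∈ box 3 (2 * (r / 8 + 1)) →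
      u ∉ box 3 (r / 8) → v ∉ box 3 (r / 8) →
      s(u + ![(r : ℤ), 0, (r : ℤ)], v + ![(r : ℤ), 0, (r : ℤ)]) ∉
        (armEdges (r / 8) (0 : Site 3) ∪ armEdges (r / 8) ![(r : ℤ), (r : ℤ), 0] ∪
          armEdges (r / 8) ![(r : ℤ), 0, (r : ℤ)] ∪ armEdges (r / 8) ![0, (r : ℤ), (r : ℤ)]) := by
  intro u v _ hu hv hum hvm
  have hm : (3 * (r / 8 : ℕ) + 2 : ℤ) < r := by push_cast; omega
  simp only [Finset.mem_union, not_or]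
  refine ⟨⟨⟨fun h => ?_, fun h => ?_⟩, fun h => ?_⟩, fun h => ?_⟩
  · have hfar : (3 * (r / 8 : ℕ) + 2 : ℤ) < (0 : Site 3) 0 - (![(r : ℤ), 0, (r : ℤ)] : Site 3) 0 ∨
        (3 * (r / 8 : ℕ) + 2 : ℤ) < (![(r : ℤ), 0, (r : ℤ)] : Site 3) 0 - (0 : Site 3) 0 := by
      right; simpa using hm
    exact (mem_box_or_of_mem_armEdges h).elim (add_neg_notMem_box_of_far hfar hu)
      (add_neg_notMem_box_of_far hfar hv)
  · have hfar : (3 * (r / 8 : ℕ) + 2 : ℤ) <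
          (![(r : ℤ), (r : ℤ), 0] : Site 3) 1 - (![(r : ℤ), 0, (r : ℤ)] : Site 3) 1 ∨
        (3 * (r / 8 : ℕ) + 2 : ℤ) <
          (![(r : ℤ), 0, (r : ℤ)] : Site 3) 1 - (![(r : ℤ), (r : ℤ), 0] : Site 3) 1 := by
      left; simpa using hm
    exact (mem_box_or_of_mem_armEdges h).elim (add_neg_notMem_box_of_far hfar hu)
      (add_neg_notMem_box_of_far hfar hv)
  · exact (mem_box_or_of_mem_armEdges h).elim (add_neg_notMem_box_self hum)
      (add_neg_notMem_box_self hvm)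
  · have hfar : (3 * (r / 8 : ℕ) + 2 : ℤ) <
          (![0, (r : ℤ), (r : ℤ)] : Site 3) 0 - (![(r : ℤ), 0, (r : ℤ)] : Site 3) 0 ∨
        (3 * (r / 8 : ℕ) + 2 : ℤ) <
          (![(r : ℤ), 0, (r : ℤ)] : Site 3) 0 - (![0, (r : ℤ), (r : ℤ)] : Site 3) 0 := by
      right; simpa using hm
    exact (mem_box_or_of_mem_armEdges h).elim (add_neg_notMem_box_of_far hfar hu)
      (add_neg_notMem_box_of_far hfar hv)

/-- The corner edge set `K_r` consists of lattice edges. -/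
theorem cornerEdges_subset_edgeSet (r : ℕ) :
    (↑(armEdges (r / 8) (0 : Site 3) ∪ armEdges (r / 8) ![(r : ℤ), (r : ℤ), 0] ∪
        armEdges (r / 8) ![(r : ℤ), 0, (r : ℤ)] ∪ armEdges (r / 8) ![0, (r : ℤ), (r : ℤ)]) :
          Set (Sym2 (Site 3))) ⊆ (zdGraph 3).edgeSet := by
  intro e he
  rw [Finset.mem_coe] at he
  simp only [Finset.mem_union] at he
  rcases he with ((h | h) | h) | h <;> exact armEdges_subset_edgeSet _ _ (Finset.mem_coe.2 h)

end StubBlock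

open StubBlock in
/-- **Conditional form of the registered stub `stub_block`** (line `SketchIdeator1` of crux
`TetrahedronHarrisGap`, stmt-CriticalPhenomena-7799): the annulus non-crossing bound
`PercAnnulusCrossing.CritAnnulusNonCrossing` (item stmt-CriticalPhenomena-0846: at `p_c(ℤ³)`,
uniformly in `n ≥ 1`, with probability `≥ c` no open path of `B(2n)` joins `B(n)` to `∂ⁱⁿB(2n)`)
implies the blocking statement: with `K_r` the lattice edges touching one of the four corner boxes
of radius `r/8` around `0, a_r = (r,r,0), b_r = (r,0,r), c_r = (0,r,r)`, for all `r ≥ 3` the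
bulk-conditional hook probabilities `P_{p_c}(0 ↔ a_r | ω off K_r)` and
`P_{p_c}(b_r ↔ c_r | ω off K_r)` vanish with probability at least `c_B = c` each — a hook from a
corner must cross the annulus `B(r/8+1) → ∂ⁱⁿB(2(r/8+1))` around that corner through bulk edges,
which the other corner boxes do not reach. -/
theorem stub_block_of_critAnnulusNonCrossing :
    Summit.CriticalPhenomena.PercolationContinuityZ3.Theses.PercAnnulusCrossing.CritAnnulusNonCrossing →
    (∃ c_B : ℝ, 0 < c_B ∧ ∃ r₀ : ℕ, ∀ r : ℕ, r₀ ≤ r →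
      c_B ≤ (bondPercolation (zdGraph 3) (criticalProbI 3)).real
          {ω | blockCondProb (zdGraph 3) (criticalProbI 3)
              (armEdges (r / 8) (0 : Site 3) ∪ armEdges (r / 8) ![(r : ℤ), (r : ℤ), 0] ∪
                armEdges (r / 8) ![(r : ℤ), 0, (r : ℤ)] ∪ armEdges (r / 8) ![0, (r : ℤ), (r : ℤ)])
              (openConn (0 : Site 3) ![(r : ℤ), (r : ℤ), 0]) ω = 0} ∧
      c_B ≤ (bondPercolation (zdGraph 3) (criticalProbI 3)).real
          {ω | blockCondProb (zdGraph 3) (criticalProbI 3)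
              (armEdges (r / 8) (0 : Site 3) ∪ armEdges (r / 8) ![(r : ℤ), (r : ℤ), 0] ∪
                armEdges (r / 8) ![(r : ℤ), 0, (r : ℤ)] ∪ armEdges (r / 8) ![0, (r : ℤ), (r : ℤ)])
              (openConn ![(r : ℤ), 0, (r : ℤ)] ![0, (r : ℤ), (r : ℤ)]) ω = 0}) := by
  rintro ⟨c, hc, hN⟩
  refine ⟨c, hc, 3, fun r hr => ⟨?_, ?_⟩⟩
  · refine le_measureReal_blockCondProb_eq_zero (criticalProbI 3) (cornerEdges_subset_edgeSet r)
      (z := 0) (m := r / 8) ?_ (not_mem_cornerEdges_zero r hr) (hN (r / 8 + 1) (Nat.succ_pos _))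
    rw [mem_box, not_forall]
    refine ⟨0, fun h => ?_⟩
    have h1 := h.2
    simp only [Pi.add_apply, Pi.neg_apply, Pi.zero_apply, Matrix.cons_val_zero] at h1
    push_cast at h1
    omega
  · refine le_measureReal_blockCondProb_eq_zero (criticalProbI 3) (cornerEdges_subset_edgeSet r)
      (z := ![(r : ℤ), 0, (r : ℤ)]) (m := r / 8) ?_ (not_mem_cornerEdges_b r hr)
      (hN (r / 8 + 1) (Nat.succ_pos _))
    rw [mem_box, not_forall]
    refine ⟨0, fun h => ?_⟩
    have h1 := h.1
    simp only [Pi.add_apply, Pi.neg_apply, Matrix.cons_val_zero] at h1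
    push_cast at h1
    omega

end Summit.CriticalPhenomena.PercolationContinuityZ3.Theorems.TetrahedronHarrisGap

end
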